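/-
Copyright (c) 2026. All rights reserved.
Released under Apache 2.0 license as described in the file LICENSE.
Authors: HodgeCM publication cell (pub-hodgecm), GR lane, seat GR-2 (`pub-hodgecm-own-hyp34`).
-/
import Literature.RepresentationTheory.HeisenbergGroup.SymplecticSiegelGenerationRestrictedProduct
import Mathlib.NumberTheory.NumberField.AdeleRing
import HarnessLib

/-!
# `Sp_{2n}(𝐀_F)` is generated by the Siegel parabolic and the Weyl element

Topic `NumberTheory/Automorphic`; namespace `Literature.NumberTheory.Automorphic`.  KERNEL ONLY: theorems, no definition,
nothing asserted.

[Weil1964, Chap. III n° 37 p. 188] forms the adelic symplectic group `Sp(X_A)` and its metaplectic cover as restricted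
products and lets them act on `𝒮(X_A)` through the local Weil representations; the operators attached to the Siegel
generators — `Φ ↦ Φ ∘ a⁻¹` (`a ∈ GL_n(𝐀)`), the second-degree characters `Φ ↦ ψ(½ ᵗu c u) Φ` (`c ∈ Sym_n(𝐀)`) and the
Fourier transform — are written down in Chap. I n° 13.  To know that these operators reach EVERY adelic symplectic
automorphism one needs the group-theoretic fact proved here:

* **`closure_generators_eq_top_adeleRing`**: for a number field `F`, `Sp_{2l}(𝐀_F) = ⟨m(GL_l(𝐀_F)), n(Sym_l(𝐀_F)), J⟩`
  (Mathlib's `Matrix.symplecticGroup l (AdeleRing (𝓞 F) F)`; `m`, `n`, `J` of `SymplecticSiegelGeneration`).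

`𝐀_F` is not a local ring, so `SymplecticSiegelGeneration.closure_generators_eq_top` does not apply; but
`𝐀_F = (∏_{v ∣ ∞} F_v) × Πʳ_v [F_v, 𝒪_v]` is a product of fields times a restricted product of fields with respect to
discrete valuation rings, all of which are local, so `𝐀_F` has the BIG-CELL SHIFT PROPERTY (every symplectic
`fromBlocks A B C D` admits a symmetric `X` with `A + X C` invertible: `bigCellReachable_adeleRing`, from
`SymplecticSiegelGenerationBigCell` / `…RestrictedProduct`), which is what generation needs.  Consumable forms:
`range_le_of_generators_mem_adeleRing` / `…'` (a homomorphism out of `Sp_{2l}(𝐀_F)` lands in a subgroup as soon as the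
generators do) and `hom_ext_adeleRing`.

## References
* [Weil1964] A. Weil, Acta Math. 111 (1964) 143–211, Chap. I n° 13, Chap. III n° 37.
* [MoeglinVignerasWaldspurger1987] C. Mœglin, M.-F. Vignéras, J.-L. Waldspurger, LNM 1291 (1987), Chap. 2 II.5.
-/

open Matrix NumberField IsDedekindDomain

namespace Literature.NumberTheory.Automorphic

open Literature.RepresentationTheory.HeisenbergGroup.SymplecticMatrix

variable {l : Type*} [DecidableEq l] [Fintype l]
variable (F : Type*) [Field F] [NumberField F]

omit [NumberField F] in
/-- **the infinite adele ring `∏_{v ∣ ∞} F_v` has the big-cell shift property** (a finite product of fields).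
[cite: Weil1964, Chap. III n° 37; MoeglinVignerasWaldspurger1987, Chap. 2 II.5] -/
theorem bigCellReachable_infiniteAdeleRing :
    ∀ ⦃A B C D : Matrix l l (InfiniteAdeleRing F)⦄, fromBlocks A B C D ∈ Matrix.symplecticGroup l (InfiniteAdeleRing F) →
      ∃ X : Matrix l l (InfiniteAdeleRing F), X.IsSymm ∧ IsUnit (A + X * C).det :=
  bigCellReachable_pi fun v : InfinitePlace F => bigCellReachable_of_isLocalRing (R := v.Completion)

/-- **the finite adele ring `Πʳ_v [F_v, 𝒪_v]` has the big-cell shift property** (a restricted product of fields with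
respect to valuation rings, both local). [cite: Weil1964, Chap. III n° 37; MoeglinVignerasWaldspurger1987, Chap. 2 II.5] -/
theorem bigCellReachable_finiteAdeleRing :
    ∀ ⦃A B C D : Matrix l l (FiniteAdeleRing (𝓞 F) F)⦄,
      fromBlocks A B C D ∈ Matrix.symplecticGroup l (FiniteAdeleRing (𝓞 F) F) →
        ∃ X : Matrix l l (FiniteAdeleRing (𝓞 F) F), X.IsSymm ∧ IsUnit (A + X * C).det :=
  bigCellReachable_restrictedProduct
    (fun v : HeightOneSpectrum (𝓞 F) => bigCellReachable_of_isLocalRing (R := v.adicCompletion F))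
    (fun v : HeightOneSpectrum (𝓞 F) => bigCellReachable_of_isLocalRing (R := v.adicCompletionIntegers F))

/-- **the adele ring `𝐀_F = F_∞ × 𝐀_F^∞` has the big-cell shift property.**
[cite: Weil1964, Chap. III n° 37; MoeglinVignerasWaldspurger1987, Chap. 2 II.5] -/
theorem bigCellReachable_adeleRing :
    ∀ ⦃A B C D : Matrix l l (AdeleRing (𝓞 F) F)⦄, fromBlocks A B C D ∈ Matrix.symplecticGroup l (AdeleRing (𝓞 F) F) →
      ∃ X : Matrix l l (AdeleRing (𝓞 F) F), X.IsSymm ∧ IsUnit (A + X * C).det :=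
  bigCellReachable_prod (bigCellReachable_infiniteAdeleRing F) (bigCellReachable_finiteAdeleRing F)

/-- **`Sp_{2l}(𝐀_F) = ⟨m(GL_l(𝐀_F)), n(Sym_l(𝐀_F)), J⟩`**: the adelic symplectic group of a number field is generated by
the Siegel parabolic and the Weyl element. [cite: Weil1964, Chap. III n° 37; MoeglinVignerasWaldspurger1987, Chap. 2 II.5]
-/
theorem closure_generators_eq_top_adeleRing :
    Subgroup.closure (generators l (AdeleRing (𝓞 F) F)) = ⊤ :=
  closure_generators_eq_top_of_bigCellReachable (bigCellReachable_adeleRing F)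

/-- A subgroup of `Sp_{2l}(𝐀_F)` containing every `m(a)`, every `n(b)` and `J` is everything.
[cite: MoeglinVignerasWaldspurger1987, Chap. 2 II.5] -/
theorem eq_top_of_generators_mem_adeleRing {H : Subgroup (Matrix.symplecticGroup l (AdeleRing (𝓞 F) F))}
    (hm : ∀ a : GL l (AdeleRing (𝓞 F) F), levi a ∈ H)
    (hn : ∀ (b : Matrix l l (AdeleRing (𝓞 F) F)) (hb : b.IsSymm), unip b hb ∈ H)
    (hJ : SymplecticGroup.symJ l (AdeleRing (𝓞 F) F) ∈ H) : H = ⊤ :=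
  eq_top_of_generators_mem_of_bigCellReachable (bigCellReachable_adeleRing F) hm hn hJ

/-- The image of `f : Sp_{2l}(𝐀_F) →* G` lies in a subgroup `K` as soon as the images of the `m(a)`, the `n(b)` and `J` do.
[cite: MoeglinVignerasWaldspurger1987, Chap. 2 II.5] -/
theorem range_le_of_generators_mem_adeleRing {G : Type*} [Group G]
    (f : Matrix.symplecticGroup l (AdeleRing (𝓞 F) F) →* G) {K : Subgroup G}
    (hm : ∀ a : GL l (AdeleRing (𝓞 F) F), f (levi a) ∈ K)
    (hn : ∀ (b : Matrix l l (AdeleRing (𝓞 F) F)) (hb : b.IsSymm), f (unip b hb) ∈ K)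
    (hJ : f (SymplecticGroup.symJ l (AdeleRing (𝓞 F) F)) ∈ K) : f.range ≤ K :=
  range_le_of_generators_mem_of_bigCellReachable (bigCellReachable_adeleRing F) f hm hn hJ

/-- The same with the opposite unipotents `v(c)`: the image of `f : Sp_{2l}(𝐀_F) →* G` lies in `K` as soon as the images
of the `m(a)`, the `v(c)` and `J` do — the form consumed by the adelic metaplectic group, whose explicit implementers are
attached to `m(a)`, `v(c)`, `J`. [cite: Weil1964, Chap. I n° 13, Chap. III n° 37] -/
theorem range_le_of_generators_mem_adeleRing' {G : Type*} [Group G]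
    (f : Matrix.symplecticGroup l (AdeleRing (𝓞 F) F) →* G) {K : Subgroup G}
    (hm : ∀ a : GL l (AdeleRing (𝓞 F) F), f (levi a) ∈ K)
    (hv : ∀ (c : Matrix l l (AdeleRing (𝓞 F) F)) (hc : c.IsSymm), f (low c hc) ∈ K)
    (hJ : f (SymplecticGroup.symJ l (AdeleRing (𝓞 F) F)) ∈ K) : f.range ≤ K :=
  range_le_of_generators_mem_of_bigCellReachable' (bigCellReachable_adeleRing F) f hm hv hJ

/-- Two homomorphisms out of `Sp_{2l}(𝐀_F)` agreeing on every `m(a)`, every `n(b)` and on `J` are equal.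
[cite: MoeglinVignerasWaldspurger1987, Chap. 2 II.5] -/
theorem hom_ext_adeleRing {G : Type*} [Group G] {φ ψ : Matrix.symplecticGroup l (AdeleRing (𝓞 F) F) →* G}
    (hm : ∀ a : GL l (AdeleRing (𝓞 F) F), φ (levi a) = ψ (levi a))
    (hn : ∀ (b : Matrix l l (AdeleRing (𝓞 F) F)) (hb : b.IsSymm), φ (unip b hb) = ψ (unip b hb))
    (hJ : φ (SymplecticGroup.symJ l (AdeleRing (𝓞 F) F)) = ψ (SymplecticGroup.symJ l (AdeleRing (𝓞 F) F))) : φ = ψ :=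
  hom_ext_of_bigCellReachable (bigCellReachable_adeleRing F) hm hn hJ

end Literature.NumberTheory.Automorphic
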